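import Summits.Ventures.HodgeRepro2.T5BergmanHilbertSpace
import Summits.Ventures.HodgeRepro2.T5BergmanCasimir

/-!
# The Lie-module structure of the weighted Bergman model on ALL holomorphic functions

The ladder of `T5BergmanLadder` acts on the monomials by coefficients. Here the three operators are
defined as DIFFERENTIAL OPERATORS on functions on the disc,

  `E₊ f = k z f + z² f'`,  `E₋ f = -f'`,  `H f = k f + 2 z f'`   (`raiseOp`, `lowerOp`, `weightOp`),

and the whole structure is established on EVERY holomorphic `f` (not only on the `K`-finite vectors):

* on the monomials they are the ladder coefficients (`raiseOp_monomial`: `E₊ zⁿ = (k+n) z^{n+1}`,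
  `lowerOp_monomial`: `E₋ zⁿ = -n z^{n-1}`, `weightOp_monomial`: `H zⁿ = (k+2n) zⁿ`);
* they are the **infinitesimal generators of the one-parameter subgroups** on every `f` differentiable
  at the point: `d/dt|₀ (π_k(a_t) f)(w) = (E₊ + E₋) f (w)` (`hasDerivAt_act_hyp`),
  `d/dt|₀ (π_k(b_t) f)(w) = -i (E₊ - E₋) f (w)` (`hasDerivAt_act_hypB`),
  `d/dθ|₀ (π_k(rot e^{iθ}) f)(w) = -i H f (w)` (`hasDerivAt_act_rot_exp`);
* on holomorphic `f` they satisfy the **`𝔰𝔩₂` relations** `[E₊, E₋] = H`, `[H, E₊] = 2 E₊`,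
  `[H, E₋] = -2 E₋` (`commutator_raise_lower`, `commutator_weight_raise`, `commutator_weight_lower`), and
* the **Casimir element** `C = ½ H² + E₊ E₋ + E₋ E₊` acts on EVERY holomorphic `f` by the scalar
  `½ k (k - 2)` (`casimir`) — the infinitesimal character of the model, now on the whole space.

Blind lane: Mathlib + the HodgeRepro2 prefix only; no sorry; axioms ⊆ {propext, Classical.choice,
Quot.sound}.
-/

namespace Summit.Ventures.HodgeRepro2.T5BergmanLieModule

open Metric Filter Topology
open T5PoincareDensity T5SU11Unimodular T5SU11Fibration T5SU11Cartan
open T5BergmanCoefficient T5BergmanLadder T5BergmanLowestWeight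

/-! ### The operators -/

/-- The raising operator `E₊ f = k z f + z² f'`. -/
noncomputable def raiseOp (k : ℕ) (f : ℂ → ℂ) : ℂ → ℂ := fun w => (k : ℂ) * w * f w + w ^ 2 * deriv f w

/-- The lowering operator `E₋ f = -f'`. -/
noncomputable def lowerOp (f : ℂ → ℂ) : ℂ → ℂ := fun w => -deriv f w

/-- The weight operator `H f = k f + 2 z f'`. -/
noncomputable def weightOp (k : ℕ) (f : ℂ → ℂ) : ℂ → ℂ := fun w => (k : ℂ) * f w + 2 * w * deriv f w

/-- `deriv (z ↦ zⁿ) w = n w^{n-1}`. -/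
lemma deriv_monomial (n : ℕ) (w : ℂ) : deriv (fun z : ℂ => z ^ n) w = (n : ℂ) * w ^ (n - 1) := by
  have := (hasDerivAt_pow n w)
  exact this.deriv

/-- `E₊ zⁿ = (k + n) z^{n+1}` (the ladder coefficient `ladderUp`). -/
theorem raiseOp_monomial (k n : ℕ) (w : ℂ) :
    raiseOp k (fun z => z ^ n) w = ((k : ℂ) + n) * w ^ (n + 1) := by
  unfold raiseOp
  rw [deriv_monomial]
  rcases n with _ | m
  · simp
  · simp only [Nat.add_sub_cancel, Nat.cast_succ]
    ring

/-- `E₋ zⁿ = -n z^{n-1}` — in particular `E₋ 1 = 0`. -/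
theorem lowerOp_monomial (n : ℕ) (w : ℂ) :
    lowerOp (fun z => z ^ n) w = -(n : ℂ) * w ^ (n - 1) := by
  unfold lowerOp
  rw [deriv_monomial]
  ring

/-- `H zⁿ = (k + 2n) zⁿ`. -/
theorem weightOp_monomial (k n : ℕ) (w : ℂ) :
    weightOp k (fun z => z ^ n) w = ((k : ℂ) + 2 * n) * w ^ n := by
  unfold weightOp
  rw [deriv_monomial]
  rcases n with _ | m
  · simp
  · simp only [Nat.add_sub_cancel, Nat.cast_succ]
    ring

/-! ### The infinitesimal generators on every differentiable `f` -/

/-- **`a_t` on a general `f`**: `(π_k(a_t) f)(w) = (cosh t - sinh t · w)^{-k} f((cosh t · w - sinh t)/(cosh t - sinh t · w))`. -/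
theorem act_hyp_apply (k : ℕ) (f : ℂ → ℂ) (t : ℝ) (w : ℂ) :
    act k (hyp t) f w = ((Real.cosh t : ℂ) - (Real.sinh t : ℂ) * w)⁻¹ ^ k *
      f (((Real.cosh t : ℂ) * w - (Real.sinh t : ℂ)) / ((Real.cosh t : ℂ) - (Real.sinh t : ℂ) * w)) := by
  unfold act
  rw [mat_hyp_inv, denom_su11, mobius_su11]
  simp only [map_neg, Complex.conj_ofReal, neg_mul]
  ring_nf

/-- **`b_t` on a general `f`**. -/
theorem act_hypB_apply (k : ℕ) (f : ℂ → ℂ) (t : ℝ) (w : ℂ) :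
    act k (hypB t) f w = ((Real.cosh t : ℂ) + Complex.I * (Real.sinh t : ℂ) * w)⁻¹ ^ k *
      f (((Real.cosh t : ℂ) * w - Complex.I * (Real.sinh t : ℂ)) /
        ((Real.cosh t : ℂ) + Complex.I * (Real.sinh t : ℂ) * w)) := by
  unfold act
  rw [mat_hypB_inv, denom_su11, mobius_su11]
  simp only [map_neg, map_mul, Complex.conj_ofReal, Complex.conj_I, neg_mul, neg_neg]
  ring_nf

/-- **The hyperbolic generator**: `d/dt|₀ (π_k(a_t) f)(w) = k w f(w) + (w² - 1) f'(w) = (E₊ + E₋) f (w)`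
for `f` differentiable at `w`. -/
theorem hasDerivAt_act_hyp (k : ℕ) (f : ℂ → ℂ) {w : ℂ} (hf : DifferentiableAt ℂ f w) :
    HasDerivAt (fun t : ℝ => act k (hyp t) f w) (raiseOp k f w + lowerOp f w) 0 := by
  simp_rw [act_hyp_apply]
  -- the automorphy factor: derivative `-w` at `t = 0`
  have h1 : HasDerivAt (fun t : ℝ => (Real.cosh t : ℂ) - (Real.sinh t : ℂ) * w) (-w) 0 := by
    have := (hasDerivAt_cosh_ofReal 0).sub ((hasDerivAt_sinh_ofReal 0).mul_const w)
    refine this.congr_deriv ?_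
    simp
  have hne : (Real.cosh 0 : ℂ) - (Real.sinh 0 : ℂ) * w ≠ 0 := by simp
  -- the Möbius argument: derivative `w² - 1` at `t = 0`
  have h2 : HasDerivAt (fun t : ℝ => (Real.cosh t : ℂ) * w - (Real.sinh t : ℂ)) (-1) 0 := by
    have := ((hasDerivAt_cosh_ofReal 0).mul_const w).sub (hasDerivAt_sinh_ofReal 0)
    refine this.congr_deriv ?_
    simp
  have hm : HasDerivAt (fun t : ℝ => ((Real.cosh t : ℂ) * w - (Real.sinh t : ℂ)) /
      ((Real.cosh t : ℂ) - (Real.sinh t : ℂ) * w)) (w ^ 2 - 1) 0 := by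
    have := h2.div h1 hne
    refine this.congr_deriv ?_
    simp
    ring
  have hm0 : ((Real.cosh 0 : ℂ) * w - (Real.sinh 0 : ℂ)) /
      ((Real.cosh 0 : ℂ) - (Real.sinh 0 : ℂ) * w) = w := by
    simp
  have hf' : HasDerivAt f (deriv f w) (((Real.cosh 0 : ℂ) * w - (Real.sinh 0 : ℂ)) /
      ((Real.cosh 0 : ℂ) - (Real.sinh 0 : ℂ) * w)) := by
    rw [hm0]
    exact hf.hasDerivAt
  have h3 := hf'.comp (0 : ℝ) hm
  have h4 := ((h1.inv hne).pow k).mul h3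
  refine h4.congr_deriv ?_
  simp only [Function.comp_def, Pi.inv_apply, Pi.pow_apply, Real.cosh_zero, Real.sinh_zero,
    Complex.ofReal_one, Complex.ofReal_zero, zero_mul, sub_zero, inv_one, one_pow, one_mul, mul_one,
    div_one]
  unfold raiseOp lowerOp
  ring

/-- **The second hyperbolic generator**: `d/dt|₀ (π_k(b_t) f)(w) = -i (E₊ - E₋) f (w)` for `f`
differentiable at `w`. -/
theorem hasDerivAt_act_hypB (k : ℕ) (f : ℂ → ℂ) {w : ℂ} (hf : DifferentiableAt ℂ f w) :
    HasDerivAt (fun t : ℝ => act k (hypB t) f w) (-Complex.I * (raiseOp k f w - lowerOp f w)) 0 := by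
  simp_rw [act_hypB_apply]
  -- the automorphy factor: derivative `i w` at `t = 0`
  have h1 : HasDerivAt (fun t : ℝ => (Real.cosh t : ℂ) + Complex.I * (Real.sinh t : ℂ) * w)
      (Complex.I * w) 0 := by
    have := (hasDerivAt_cosh_ofReal 0).add
      (((hasDerivAt_sinh_ofReal 0).const_mul Complex.I).mul_const w)
    refine this.congr_deriv ?_
    simp
  have hne : (Real.cosh 0 : ℂ) + Complex.I * (Real.sinh 0 : ℂ) * w ≠ 0 := by simp
  -- the Möbius argument: derivative `-i (1 + w²)` at `t = 0`
  have h2 : HasDerivAt (fun t : ℝ => (Real.cosh t : ℂ) * w - Complex.I * (Real.sinh t : ℂ))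
      (-Complex.I) 0 := by
    have := ((hasDerivAt_cosh_ofReal 0).mul_const w).sub
      ((hasDerivAt_sinh_ofReal 0).const_mul Complex.I)
    refine this.congr_deriv ?_
    simp
  have hm : HasDerivAt (fun t : ℝ => ((Real.cosh t : ℂ) * w - Complex.I * (Real.sinh t : ℂ)) /
      ((Real.cosh t : ℂ) + Complex.I * (Real.sinh t : ℂ) * w)) (-Complex.I - Complex.I * w ^ 2) 0 := by
    have := h2.div h1 hne
    refine this.congr_deriv ?_
    simp
    ring
  have hm0 : ((Real.cosh 0 : ℂ) * w - Complex.I * (Real.sinh 0 : ℂ)) /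
      ((Real.cosh 0 : ℂ) + Complex.I * (Real.sinh 0 : ℂ) * w) = w := by
    simp
  have hf' : HasDerivAt f (deriv f w) (((Real.cosh 0 : ℂ) * w - Complex.I * (Real.sinh 0 : ℂ)) /
      ((Real.cosh 0 : ℂ) + Complex.I * (Real.sinh 0 : ℂ) * w)) := by
    rw [hm0]
    exact hf.hasDerivAt
  have h3 := hf'.comp (0 : ℝ) hm
  have h4 := ((h1.inv hne).pow k).mul h3
  refine h4.congr_deriv ?_
  simp only [Function.comp_def, Pi.inv_apply, Pi.pow_apply, Real.cosh_zero, Real.sinh_zero,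
    Complex.ofReal_one, Complex.ofReal_zero, zero_mul, mul_zero, sub_zero, add_zero, inv_one, one_pow,
    one_mul, mul_one, div_one]
  unfold raiseOp lowerOp
  ring

/-- `(π_k(rot e^{iθ}) f)(w) = e^{-ikθ} f(e^{-2iθ} w)`. -/
theorem act_rot_exp_apply (k : ℕ) (f : ℂ → ℂ) (θ : ℝ) (w : ℂ) :
    act k (rot (Circle.exp θ)) f w =
      Complex.exp (-(k : ℂ) * Complex.I * θ) * f (Complex.exp (-2 * Complex.I * θ) * w) := by
  rw [act_rot, Circle.coe_exp, ← Complex.exp_neg, ← Complex.exp_nat_mul, ← Complex.exp_nat_mul]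
  congr 2 <;> push_cast <;> ring

/-- **The rotation generator**: `d/dθ|₀ (π_k(rot e^{iθ}) f)(w) = -i H f (w)` for `f` differentiable at `w`. -/
theorem hasDerivAt_act_rot_exp (k : ℕ) (f : ℂ → ℂ) {w : ℂ} (hf : DifferentiableAt ℂ f w) :
    HasDerivAt (fun θ : ℝ => act k (rot (Circle.exp θ)) f w) (-Complex.I * weightOp k f w) 0 := by
  simp_rw [act_rot_exp_apply]
  have hlin : ∀ c : ℂ, HasDerivAt (fun θ : ℝ => c * (θ : ℂ)) c 0 := by
    intro c
    simpa using (Complex.ofRealCLM.hasDerivAt (x := (0 : ℝ))).const_mul c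
  have h1 : HasDerivAt (fun θ : ℝ => Complex.exp (-(k : ℂ) * Complex.I * θ))
      (Complex.exp (-(k : ℂ) * Complex.I * (0 : ℝ)) * (-(k : ℂ) * Complex.I)) 0 :=
    (Complex.hasDerivAt_exp _).comp (0 : ℝ) (hlin _)
  have h2 : HasDerivAt (fun θ : ℝ => Complex.exp (-2 * Complex.I * θ) * w)
      (Complex.exp (-2 * Complex.I * (0 : ℝ)) * (-2 * Complex.I) * w) 0 :=
    ((Complex.hasDerivAt_exp _).comp (0 : ℝ) (hlin _)).mul_const w
  have h20 : Complex.exp (-2 * Complex.I * ((0 : ℝ) : ℂ)) * w = w := by simp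
  have hf' : HasDerivAt f (deriv f w) (Complex.exp (-2 * Complex.I * ((0 : ℝ) : ℂ)) * w) := by
    rw [h20]
    exact hf.hasDerivAt
  have h3 := hf'.comp (0 : ℝ) h2
  have h4 := h1.mul h3
  refine h4.congr_deriv ?_
  simp only [Function.comp_def, Complex.ofReal_zero, mul_zero, Complex.exp_zero, one_mul]
  unfold weightOp
  ring

/-! ### The `𝔰𝔩₂` relations and the Casimir on holomorphic functions -/

/-- On the open disc a holomorphic `f` has a differentiable derivative. -/
lemma differentiableAt_deriv {f : ℂ → ℂ} (hf : DifferentiableOn ℂ f (ball 0 1)) {w : ℂ}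
    (hw : w ∈ ball (0 : ℂ) 1) : DifferentiableAt ℂ (deriv f) w :=
  ((hf.analyticOnNhd isOpen_ball).deriv w hw).differentiableAt

/-- `E₊ f` is differentiable on the disc with derivative `k f + (k + 2) w f' + w² f''`. -/
lemma hasDerivAt_raiseOp (k : ℕ) {f : ℂ → ℂ} (hf : DifferentiableOn ℂ f (ball 0 1)) {w : ℂ}
    (hw : w ∈ ball (0 : ℂ) 1) :
    HasDerivAt (raiseOp k f)
      ((k : ℂ) * f w + ((k : ℂ) + 2) * w * deriv f w + w ^ 2 * deriv (deriv f) w) w := by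
  have hf1 : HasDerivAt f (deriv f w) w := (hf.differentiableAt (isOpen_ball.mem_nhds hw)).hasDerivAt
  have hf2 : HasDerivAt (deriv f) (deriv (deriv f) w) w := (differentiableAt_deriv hf hw).hasDerivAt
  have h := (((hasDerivAt_id w).const_mul (k : ℂ)).mul hf1).add ((hasDerivAt_pow 2 w).mul hf2)
  refine h.congr_deriv ?_
  simp only [id]
  ring

/-- `E₋ f` is differentiable on the disc with derivative `-f''`. -/
lemma hasDerivAt_lowerOp {f : ℂ → ℂ} (hf : DifferentiableOn ℂ f (ball 0 1)) {w : ℂ}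
    (hw : w ∈ ball (0 : ℂ) 1) : HasDerivAt (lowerOp f) (-deriv (deriv f) w) w :=
  (differentiableAt_deriv hf hw).hasDerivAt.neg

/-- `H f` is differentiable on the disc with derivative `(k + 2) f' + 2 w f''`. -/
lemma hasDerivAt_weightOp (k : ℕ) {f : ℂ → ℂ} (hf : DifferentiableOn ℂ f (ball 0 1)) {w : ℂ}
    (hw : w ∈ ball (0 : ℂ) 1) :
    HasDerivAt (weightOp k f) (((k : ℂ) + 2) * deriv f w + 2 * w * deriv (deriv f) w) w := by
  have hf1 : HasDerivAt f (deriv f w) w := (hf.differentiableAt (isOpen_ball.mem_nhds hw)).hasDerivAt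
  have hf2 : HasDerivAt (deriv f) (deriv (deriv f) w) w := (differentiableAt_deriv hf hw).hasDerivAt
  have h := (hf1.const_mul (k : ℂ)).add (((hasDerivAt_id w).const_mul (2 : ℂ)).mul hf2)
  refine h.congr_deriv ?_
  simp only [id]
  ring

/-- **`[E₊, E₋] = H`** on holomorphic functions on the disc. -/
theorem commutator_raise_lower (k : ℕ) {f : ℂ → ℂ} (hf : DifferentiableOn ℂ f (ball 0 1)) {w : ℂ}
    (hw : w ∈ ball (0 : ℂ) 1) :
    raiseOp k (lowerOp f) w - lowerOp (raiseOp k f) w = weightOp k f w := by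
  have e1 : deriv (lowerOp f) w = -deriv (deriv f) w := (hasDerivAt_lowerOp hf hw).deriv
  have e2 : deriv (raiseOp k f) w =
      (k : ℂ) * f w + ((k : ℂ) + 2) * w * deriv f w + w ^ 2 * deriv (deriv f) w :=
    (hasDerivAt_raiseOp k hf hw).deriv
  simp only [raiseOp, lowerOp, weightOp] at e1 e2 ⊢
  rw [e1, e2]
  ring

/-- **`[H, E₊] = 2 E₊`** on holomorphic functions on the disc. -/
theorem commutator_weight_raise (k : ℕ) {f : ℂ → ℂ} (hf : DifferentiableOn ℂ f (ball 0 1)) {w : ℂ}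
    (hw : w ∈ ball (0 : ℂ) 1) :
    weightOp k (raiseOp k f) w - raiseOp k (weightOp k f) w = 2 * raiseOp k f w := by
  have e1 := (hasDerivAt_raiseOp k hf hw).deriv
  have e2 := (hasDerivAt_weightOp k hf hw).deriv
  simp only [raiseOp, weightOp] at e1 e2 ⊢
  rw [e1, e2]
  ring

/-- **`[H, E₋] = -2 E₋`** on holomorphic functions on the disc. -/
theorem commutator_weight_lower (k : ℕ) {f : ℂ → ℂ} (hf : DifferentiableOn ℂ f (ball 0 1)) {w : ℂ}
    (hw : w ∈ ball (0 : ℂ) 1) :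
    weightOp k (lowerOp f) w - lowerOp (weightOp k f) w = -2 * lowerOp f w := by
  have e1 := (hasDerivAt_lowerOp hf hw).deriv
  have e2 := (hasDerivAt_weightOp k hf hw).deriv
  simp only [lowerOp, weightOp] at e1 e2 ⊢
  rw [e1, e2]
  ring

/-- **The Casimir element is the scalar `½ k (k - 2)` on EVERY holomorphic function on the disc**:
`½ H (H f) + E₊ (E₋ f) + E₋ (E₊ f) = ½ k (k - 2) f`. -/
theorem casimir (k : ℕ) {f : ℂ → ℂ} (hf : DifferentiableOn ℂ f (ball 0 1)) {w : ℂ}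
    (hw : w ∈ ball (0 : ℂ) 1) :
    (1 / 2 : ℂ) * weightOp k (weightOp k f) w + raiseOp k (lowerOp f) w + lowerOp (raiseOp k f) w =
      (1 / 2 : ℂ) * (k : ℂ) * ((k : ℂ) - 2) * f w := by
  have e1 := (hasDerivAt_lowerOp hf hw).deriv
  have e2 := (hasDerivAt_raiseOp k hf hw).deriv
  have e3 := (hasDerivAt_weightOp k hf hw).deriv
  simp only [raiseOp, lowerOp, weightOp] at e1 e2 e3 ⊢
  rw [e1, e2, e3]
  ring

/-- The Casimir scalar agrees with `T5BergmanCasimir`'s monomial value `casimirScalar k n`. -/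
theorem casimir_eq_casimirScalar (k n : ℕ) :
    (1 / 2 : ℂ) * (k : ℂ) * ((k : ℂ) - 2) = T5BergmanCasimir.casimirScalar k n := by
  rw [T5BergmanCasimir.casimir_monomial_eq_zero_case, T5BergmanCasimir.casimir_lowest]

end Summit.Ventures.HodgeRepro2.T5BergmanLieModule
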